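import Summits.QuantumFields.GaugeBoot.DiagonalRPTorusHexLocal
import HarnessLib

/-!
# The local `ℤ³` chart: stars of links and the rest test (gauge-boot, L3 `d = 3` uniform window, J1 brick 1b/4)

HONEST FRAMING (cell `pub-gaugeboot`, page 1 of every file): the venture produces certified bounds
on lattice expectations at stated coupling, gauge group, dimension and torus size; NOT a mass gap,
NOT a continuum limit, NOT a string tension; NOT Yang–Mills-summit-bearing (barriers
`FixedCouplingUltralocality`, `PerturbativeInvisibility`). This module is bookkeeping for a
structural NEGATIVE result (a coupling window UNIFORM in the torus size for the failure of
inner-half diagonal reflection positivity on `(ℤ/L)^3`, plan note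
`HOME/pub-gaugeboot-lean3/gen46/D3-UNIFORM-PLAN.md` §3 item 6c (J1)); it discharges nothing by
itself.

## Content (chart `DiagRPHex.site y` of `DiagonalRPTorusHexLocal`, torus `(ℤ/L)^3`, `L = 2c`)

* ★ `exists_mem_lstar_of_hasLink` — EVERY torus plaquette through a charted link is the chart
  image of one of the four local plaquettes `lstar ℓ` through it (no injectivity needed: the
  chart is defined on all of `ℤ³` and intertwines the shifts); `inBox_of_mem_lstar`.
* `dvo`, `loff_lvert`, `loff_dichotomy` — layer offsets of the vertices of a local plaquette; off
  the back layer they are all `≤ 0` or all `≥ 2`.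
* ★ `mem_restPlaqs_of_lrest` / `lrest_of_mem_restPlaqs` — for a base on the layer
  `δ(y) = c - 1` and plaquettes of the box (`2B + 2 < c`), membership in
  `DiagRPTube.restPlaqs 0 1 c` IS the local test `lrest` (a vertex on the back layer), by
  `DiagRPRest.mem_restPlaqs_of_lay_vert` and `DiagRPTube.not_mem_restPlaqs_of_(neg_)layers`.

Elementary bookkeeping; no named fact.
-/

open Finset Function

namespace Summit.QuantumFields.GaugeBoot

open Literature.MathematicalPhysics.QuantumFieldTheory

namespace DiagRPHex

open DiagRPTube
open DiagRPRest (mem_restPlaqs_of_lay_vert)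

section Chart

variable {L : ℕ} (y : Site 3 L)

/-! ### The four plaquettes through a link -/

/-- Every local plaquette of `lstar ℓ` contains `ℓ`. -/
theorem mem_llinks_of_mem_lstar {ℓ : LEdge} {p : LPlaq} (hp : p ∈ lstar ℓ) : ℓ ∈ llinks p := by
  obtain ⟨x, μ⟩ := ℓ
  fin_cases μ <;> simp only [lstar, List.mem_cons, List.not_mem_nil, or_false] at hp <;>
    rcases hp with rfl | rfl | rfl | rfl <;>
    simp [llinks, llink, pm, pn, lvec, sub_add_cancel]

/-- ★ **Every torus plaquette through a charted link is the chart of a local plaquette through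
it.** (No injectivity is needed: the chart is defined on all of `ℤ³`.) -/
theorem exists_mem_lstar_of_hasLink {q : Plaquette 3 L} {ℓ : LEdge} (h : HasLink q (edge y ℓ)) :
    ∃ p ∈ lstar ℓ, q = plaq y p := by
  obtain ⟨s, ⟨⟨m, n⟩, hmn⟩⟩ := q
  obtain ⟨x, μ⟩ := ℓ
  obtain ⟨a, ha⟩ := h
  simp only [edge] at ha
  -- the three planes
  have hplanes : (m = 0 ∧ n = 1) ∨ (m = 0 ∧ n = 2) ∨ (m = 1 ∧ n = 2) := by
    fin_cases m <;> fin_cases n <;> simp at hmn ⊢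
  rcases hplanes with ⟨rfl, rfl⟩ | ⟨rfl, rfl⟩ | ⟨rfl, rfl⟩ <;> fin_cases a <;>
    simp only [link, Prod.mk.injEq] at ha <;> obtain ⟨hs, hμ⟩ := ha <;> subst hμ
  -- plane (0,1)
  · exact ⟨(x, 0), by simp [lstar], by simp [plaq, plane, hs]⟩
  · refine ⟨(x - lvec 0, 0), by simp [lstar], ?_⟩
    simp only [plaq, plane]
    congr 1
    have := site_sub_lvec_shift y x 0
    rw [← hs] at this
    exact (add_left_injective _ this).symm
  · refine ⟨(x - lvec 1, 0), by simp [lstar], ?_⟩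
    simp only [plaq, plane]
    congr 1
    have := site_sub_lvec_shift y x 1
    rw [← hs] at this
    exact (add_left_injective _ this).symm
  · exact ⟨(x, 0), by simp [lstar], by simp [plaq, plane, hs]⟩
  -- plane (0,2)
  · exact ⟨(x, 1), by simp [lstar], by simp [plaq, plane, hs]⟩
  · refine ⟨(x - lvec 0, 1), by simp [lstar], ?_⟩
    simp only [plaq, plane]
    congr 1
    have := site_sub_lvec_shift y x 0
    rw [← hs] at this
    exact (add_left_injective _ this).symm
  · refine ⟨(x - lvec 2, 1), by simp [lstar], ?_⟩
    simp only [plaq, plane]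
    congr 1
    have := site_sub_lvec_shift y x 2
    rw [← hs] at this
    exact (add_left_injective _ this).symm
  · exact ⟨(x, 1), by simp [lstar], by simp [plaq, plane, hs]⟩
  -- plane (1,2)
  · exact ⟨(x, 2), by simp [lstar], by simp [plaq, plane, hs]⟩
  · refine ⟨(x - lvec 1, 2), by simp [lstar], ?_⟩
    simp only [plaq, plane]
    congr 1
    have := site_sub_lvec_shift y x 1
    rw [← hs] at this
    exact (add_left_injective _ this).symm
  · refine ⟨(x - lvec 2, 2), by simp [lstar], ?_⟩
    simp only [plaq, plane]
    congr 1
    have := site_sub_lvec_shift y x 2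
    rw [← hs] at this
    exact (add_left_injective _ this).symm
  · exact ⟨(x, 2), by simp [lstar], by simp [plaq, plane, hs]⟩

/-- The bases of the plaquettes through a link of the box lie in the next box. -/
theorem inBox_of_mem_lstar {B : ℕ} {ℓ : LEdge} (hℓ : InBox B ℓ.1) {p : LPlaq} (hp : p ∈ lstar ℓ) :
    InBox (B + 1) p.1 := by
  obtain ⟨x, μ⟩ := ℓ
  obtain ⟨h1, h2, h3⟩ := hℓ
  have hB : (B : ℤ) ≤ (B + 1 : ℕ) := by push_cast; linarith
  fin_cases μ <;> simp only [lstar, List.mem_cons, List.not_mem_nil, or_false] at hp <;>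
    rcases hp with rfl | rfl | rfl | rfl <;>
    refine ⟨?_, ?_, ?_⟩ <;>
    simp only [lvec, Prod.fst_sub, Prod.snd_sub, sub_zero] <;>
    first
      | exact h1.trans hB | exact h2.trans hB | exact h3.trans hB
      | (refine (abs_sub _ _).trans ?_; push_cast; simp; linarith)

/-! ### The rest test -/

/-- The layer offset of a vertex relative to the base, by plane code and vertex index. -/
def dvo : Fin 3 → Fin 4 → ℤ
  | 0, 0 => 0 | 0, 1 => 1 | 0, 2 => -1 | 0, 3 => 0
  | 1, 0 => 0 | 1, 1 => 1 | 1, 2 => 0 | 1, 3 => 1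
  | 2, 0 => 0 | 2, 1 => -1 | 2, 2 => 0 | 2, 3 => -1

/-- Layer offsets of the four vertices. -/
theorem loff_lvert (p : LPlaq) (a : Fin 4) : loff (lvert p a) = loff p.1 + dvo p.2 a := by
  obtain ⟨x, t⟩ := p
  fin_cases t <;> fin_cases a <;> simp [loff, lvert, lvec, pm, pn, dvo] <;> ring

/-- **Dichotomy off the back layer**: if no vertex lies on `loff = 1`, all vertices lie weakly
below (`loff ≤ 0`) or all strictly above (`loff ≥ 2`). -/
theorem loff_dichotomy {p : LPlaq} (h : lrest p = false) :
    (∀ a, loff (lvert p a) ≤ 0) ∨ (∀ a, 2 ≤ loff (lvert p a)) := by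
  simp only [lrest, Bool.or_eq_false_iff, beq_eq_false_iff_ne, ne_eq] at h
  obtain ⟨⟨⟨h0, h1⟩, h2⟩, h3⟩ := h
  obtain ⟨x, t⟩ := p
  simp only [loff_lvert] at h0 h1 h2 h3 ⊢
  fin_cases t <;> simp only [dvo] at h0 h1 h2 h3 <;>
  · rcases le_or_gt (loff x) 0 with hx | hx
    · left; intro a; fin_cases a <;> simp only [dvo] <;> omega
    · right; intro a; fin_cases a <;> simp only [dvo] <;> omega

/-- Vertices of a box plaquette have small layer offsets. -/
theorem abs_loff_lvert_le {B : ℕ} {p : LPlaq} (hp : InBox B p.1) (a : Fin 4) :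
    |loff (lvert p a)| ≤ 2 * B + 1 := by
  rw [loff_lvert]
  obtain ⟨h1, h2, -⟩ := hp
  have hx : |loff p.1| ≤ 2 * B := by
    unfold loff
    exact (abs_sub _ _).trans (by linarith)
  obtain ⟨x, t⟩ := p
  rw [abs_le] at hx ⊢
  fin_cases t <;> fin_cases a <;> simp only [dvo] <;> constructor <;> linarith [hx.1, hx.2]

variable {y} [NeZero L] {c : ℕ}

/-- ★ **The local rest test implies membership in the rest** (base layer `δ(y) = c - 1`). -/
theorem mem_restPlaqs_of_lrest (hc : 2 ≤ c) (hL : L = 2 * c)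
    (hy : lay (0 : Fin 3) 1 y = ((c - 1 : ℕ) : ZMod L)) {p : LPlaq} (h : lrest p = true) :
    plaq y p ∈ restPlaqs (0 : Fin 3) 1 c := by
  simp only [lrest, Bool.or_eq_true, beq_iff_eq] at h
  have key : ∀ a : Fin 4, loff (lvert p a) = 1 → plaq y p ∈ restPlaqs (0 : Fin 3) 1 c := by
    intro a ha
    refine mem_restPlaqs_of_lay_vert hc hL a ?_
    rw [vert_plaq, lay_site, hy, ha, Int.cast_one, ← Nat.cast_add_one, Nat.sub_add_cancel (by omega)]
  rcases h with ((h | h) | h) | h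
  exacts [key 0 h, key 1 h, key 2 h, key 3 h]

/-- ★ **Membership in the rest implies the local rest test**, for plaquettes of the box
(`2B + 2 < c`). -/
theorem lrest_of_mem_restPlaqs (hL : L = 2 * c) (hy : lay (0 : Fin 3) 1 y = ((c - 1 : ℕ) : ZMod L))
    {B : ℕ} (hBc : 2 * B + 2 < c) {p : LPlaq} (hp : InBox B p.1)
    (h : plaq y p ∈ restPlaqs (0 : Fin 3) 1 c) : lrest p = true := by
  by_contra hne
  rw [Bool.not_eq_true] at hne
  have hc : 2 ≤ c := by omega
  have habs := abs_loff_lvert_le hp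
  rcases loff_dichotomy hne with hlow | hhigh
  · -- all vertices on the layers `c - 1 - k`, `0 ≤ k ≤ 2B+1 < c - 1`: inner
    refine not_mem_restPlaqs_of_layers (i := (0 : Fin 3)) (j := 1) (h := c) (fun a => ?_) ⟨0, ?_⟩ h
    · obtain ⟨k, hk, hka⟩ : ∃ k : ℕ, k ≤ 2 * B + 1 ∧ loff (lvert p a) = -(k : ℤ) := by
        refine ⟨(-loff (lvert p a)).toNat, ?_, ?_⟩
        · have := (abs_le.1 (habs a)).1; have := hlow a; omega
        · have := hlow a; omega
      rw [vert_plaq, lay_site, hy, hka]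
      have : ((c - 1 : ℕ) : ZMod L) + ((-(k : ℤ) : ℤ) : ZMod L) = ((c - 1 - k : ℕ) : ZMod L) := by
        have hk' : k ≤ c - 1 := by omega
        rw [Nat.cast_sub hk']; push_cast; ring
      rw [this]
      exact DiagRPTube.val_cast_lt hL (by omega)
    · obtain ⟨k, hk, hka⟩ : ∃ k : ℕ, k ≤ 2 * B + 1 ∧ loff (lvert p 0) = -(k : ℤ) := by
        refine ⟨(-loff (lvert p 0)).toNat, ?_, ?_⟩
        · have := (abs_le.1 (habs 0)).1; have := hlow 0; omega
        · have := hlow 0; omega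
      rw [vert_plaq, lay_site, hy, hka]
      have : ((c - 1 : ℕ) : ZMod L) + ((-(k : ℤ) : ℤ) : ZMod L) = ((c - 1 - k : ℕ) : ZMod L) := by
        have hk' : k ≤ c - 1 := by omega
        rw [Nat.cast_sub hk']; push_cast; ring
      rw [this]
      intro h0
      have := congrArg ZMod.val h0
      rw [val_cast (by omega), ZMod.val_zero] at this
      omega
  · -- all vertices on the layers `c - 1 + k`, `2 ≤ k ≤ 2B+1`: mirror images of inner ones
    refine not_mem_restPlaqs_of_neg_layers (i := (0 : Fin 3)) (j := 1) (h := c) (fun a => ?_) ⟨0, ?_⟩ h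
    · obtain ⟨k, hk2, hk, hka⟩ : ∃ k : ℕ, 2 ≤ k ∧ k ≤ 2 * B + 1 ∧ loff (lvert p a) = (k : ℤ) := by
        refine ⟨(loff (lvert p a)).toNat, ?_, ?_, ?_⟩
        · have := hhigh a; omega
        · have := (abs_le.1 (habs a)).2; have := hhigh a; omega
        · have := hhigh a; omega
      rw [vert_plaq, lay_site, hy, hka]
      have : -(((c - 1 : ℕ) : ZMod L) + ((k : ℤ) : ZMod L)) = ((c + 1 - k : ℕ) : ZMod L) := by
        have h2c : ((2 * c : ℕ) : ZMod L) = 0 := by rw [← hL]; exact ZMod.natCast_self L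
        have hk' : k ≤ c + 1 := by omega
        rw [Nat.cast_sub hk', Nat.cast_sub (by omega : 1 ≤ c)]
        push_cast at h2c ⊢
        linear_combination -h2c
      rw [this]
      exact DiagRPTube.val_cast_lt hL (by omega)
    · obtain ⟨k, hk2, hk, hka⟩ : ∃ k : ℕ, 2 ≤ k ∧ k ≤ 2 * B + 1 ∧ loff (lvert p 0) = (k : ℤ) := by
        refine ⟨(loff (lvert p 0)).toNat, ?_, ?_, ?_⟩
        · have := hhigh 0; omega
        · have := (abs_le.1 (habs 0)).2; have := hhigh 0; omega
        · have := hhigh 0; omega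
      rw [vert_plaq, lay_site, hy, hka]
      have : ((c - 1 : ℕ) : ZMod L) + ((k : ℤ) : ZMod L) = ((c - 1 + k : ℕ) : ZMod L) := by push_cast; ring
      rw [this]
      intro h0
      have := congrArg ZMod.val h0
      rw [val_cast (by omega), ZMod.val_zero] at this
      omega

end Chart

end DiagRPHex

end Summit.QuantumFields.GaugeBoot
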